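import Mathlib.LinearAlgebra.Matrix.ToLin
import Mathlib.LinearAlgebra.Trace
import Mathlib.RingTheory.Polynomial.Cyclotomic.Roots
import Literature.NumberTheory.EllipticCurves.WeilPairingProofs
import Literature.NumberTheory.GaloisRepresentations.ModPGaloisRepCyclotomicProofs
import Literature.NumberTheory.GaloisRepresentations.CyclotomicCharacterSurjectiveProofs
import Literature.NumberTheory.GaloisRepresentations.ModNCyclotomicCharacter
import HarnessLib

/-!
# Serre 1972, §5.2 (iii)–(iv): `det φ_l` is onto `𝔽_lˣ`, and complex conjugation, for `E/ℚ`

Topic `NumberTheory/EllipticCurves`.  Theorems only (nothing is defined, no named fact): the two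
pieces of global information on the image `φ_l(G) ⊆ Aut(E_l) ≅ GL₂(𝔽_l)` of the mod-`l` Galois
representation of an elliptic curve over `ℚ` that J.-P. Serre, *Propriétés galoisiennes des
points d'ordre fini des courbes elliptiques*, Invent. Math. 15 (1972), lists in §5.2 and uses in
§4.2 / §5.4 of the proof of the open image theorem (the tree's named fact
`Literature.NumberTheory.EllipticCurves.serre_open_image`):

> (iii) L'homomorphisme `det : φ_l(G) → 𝔽_lˣ` est *surjectif*; en effet, on sait que son image
> est le groupe de Galois du `l`-ième corps cyclotomique.
> (iv) `φ_l(G)` contient un élément `c` de valeurs propres `{1, -1}`: celui fourni par la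
> conjugaison complexe.

in the tree's language: `ρ̄_{E,ℓ} = galoisRepTorsion W ℓ : Γ_ℚ → Aut(E[ℓ])` (`GaloisAction`),
framed by a basis of the `𝔽_ℓ`-plane `E[ℓ]` (`exists_addEquiv_mulEquiv_addAut_GL2`: an additive
frame `e : E[ℓ] ≃+ 𝔽_ℓ²` together with the group isomorphism `Φ : Aut(E[ℓ]) ≅ GL₂(𝔽_ℓ)` it
induces, compatible with `mulVec`, traces and determinants), the determinant being the mod-`ℓ`
cyclotomic character `modPCyclotomicCharacterZMod ℚ ℓ` by the Weil pairing (the tree's theorems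
`det_eq_modPCyclotomicCharacterZMod_of_exists_weilPairing`, `exists_weilPairing_holds`,
Silverman *AEC* III.8), which is onto (`GaloisRep.cyclotomicCharacter_surjective` with the
irreducibility of the cyclotomic polynomials over `ℚ`) and takes the value `-1` at a complex
conjugation (`exists_isComplexConjugation`, `modNCyclotomicCharacter_of_isComplexConjugation`).

* `Literature.NumberTheory.EllipticCurves.exists_addEquiv_mulEquiv_addAut_GL2` — framing an
  `𝔽_ℓ`-plane.
* `WeierstrassCurve.det_frame_galoisRepTorsion_eq` — `det Φ(ρ̄_{E,ℓ} σ) = χ̄_ℓ(σ)` (any perfect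
  base field of characteristic `≠ ℓ`).
* `Literature.NumberTheory.EllipticCurves.modPCyclotomicCharacterZMod_rat_surjective` — §5.2 (iii)
  for `ℚ`: `χ̄_ℓ : Γ_ℚ → 𝔽_ℓˣ` is onto;
  `Literature.NumberTheory.EllipticCurves.exists_sq_eq_one_modPCyclotomicCharacterZMod_eq_neg_one`
  — §5.2 (iv): a `c ∈ Γ_ℚ` with `c² = 1`, `χ̄_ℓ(c) = -1`.
* `WeierstrassCurve.exists_frame_galoisRepTorsion_rat` — the assembled statement for `E/ℚ`: a
  frame `(e, Φ)` of `E[ℓ]` with `det ∘ Φ ∘ ρ̄_{E,ℓ} = χ̄_ℓ` onto `𝔽_ℓˣ` and an element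
  `c = ρ̄_{E,ℓ}(conj)` with `c² = 1`, `det Φ(c) = -1` — the hypotheses `hdet`, `hc`, `hdet` of the
  group-theoretic lemmas of `GaloisRepresentations/SerreOpenImageGroupLemmas`.

## References

* [Serre1972] J.-P. Serre, Invent. Math. 15 (1972) 259–331, §5.2 (iii), (iv); §4.2; §5.4.
* [SilvermanAEC2009] J. H. Silverman, *The Arithmetic of Elliptic Curves*, 2nd ed., III.8
  (Weil pairing, `det ρ̄ = χ̄`).
-/

noncomputable section

open scoped Classical
open Matrix

universe u

namespace Literature.NumberTheory.EllipticCurves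

/-! ### Framing an `𝔽_ℓ`-plane -/

section Plane

variable {ℓ : ℕ} [Fact ℓ.Prime] (A : Type u) [AddCommGroup A] [Module (ZMod ℓ) A]

/-- **Framing `Aut(A)` for an `𝔽_ℓ`-plane `A`** (an abelian group with `ℓ²` elements with its
`𝔽_ℓ`-module structure): a basis gives an additive frame `e : A ≃+ 𝔽_ℓ²` and a group
isomorphism `Φ : Aut(A) ≅ GL₂(𝔽_ℓ)` (additive automorphisms are `𝔽_ℓ`-linear) such that
`e (g x) = Φ(g) e(x)`, `tr Φ(g) = tr g` and `det Φ(g) = det g` ("`φ_l : G → Aut(E_l) ≅ GL₂(𝔽_l)`",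
§4.1). [cite: Serre1972, §4.1] -/
theorem exists_addEquiv_mulEquiv_addAut_GL2 (hA : Nat.card A = ℓ ^ 2) :
    ∃ (e : A ≃+ (Fin 2 → ZMod ℓ)) (Φ : Multiplicative (AddAut A) ≃* GL (Fin 2) (ZMod ℓ)),
      (∀ (g : Multiplicative (AddAut A)) (x : A),
        e (Multiplicative.toAdd g x) =
          ((Φ g : GL (Fin 2) (ZMod ℓ)) : Matrix (Fin 2) (Fin 2) (ZMod ℓ)) *ᵥ e x) ∧
      (∀ g : Multiplicative (AddAut A),
        Matrix.trace ((Φ g : GL (Fin 2) (ZMod ℓ)) : Matrix (Fin 2) (Fin 2) (ZMod ℓ)) =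
          LinearMap.trace (ZMod ℓ) A ((Multiplicative.toAdd g).toAddMonoidHom.toZModLinearMap ℓ)) ∧
      (∀ g : Multiplicative (AddAut A),
        Matrix.det ((Φ g : GL (Fin 2) (ZMod ℓ)) : Matrix (Fin 2) (Fin 2) (ZMod ℓ)) =
          LinearMap.det ((Multiplicative.toAdd g).toAddMonoidHom.toZModLinearMap ℓ)) := by
  have hp : ℓ.Prime := Fact.out
  haveI : Finite A := Nat.finite_of_card_ne_zero (by rw [hA]; exact pow_ne_zero _ hp.ne_zero)
  haveI : Module.Finite (ZMod ℓ) A := Module.Finite.of_finite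
  have hrank : Module.finrank (ZMod ℓ) A = 2 := by
    haveI : Module.Free (ZMod ℓ) A := Module.Free.of_divisionRing _ _
    have h := Module.natCard_eq_pow_finrank (K := ZMod ℓ) (V := A)
    rw [hA, Nat.card_zmod] at h
    exact (Nat.pow_right_injective hp.two_le h).symm
  let c : Module.Basis (Fin 2) (ZMod ℓ) A := Module.finBasisOfFinrankEq (ZMod ℓ) A hrank
  -- additive automorphisms as linear maps
  let lin : AddAut A → (A →ₗ[ZMod ℓ] A) := fun g ↦ g.toAddMonoidHom.toZModLinearMap ℓ
  have hlin : ∀ g x, lin g x = g x := fun g x ↦ rfl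
  have hlin_comp_symm : ∀ g : AddAut A, (lin g).comp (lin g.symm) = LinearMap.id := fun g ↦
    LinearMap.ext fun x ↦ by simp [hlin]
  have hlin_symm_comp : ∀ g : AddAut A, (lin g.symm).comp (lin g) = LinearMap.id := fun g ↦
    LinearMap.ext fun x ↦ by simp [hlin]
  have hlin_mul : ∀ a b : Multiplicative (AddAut A),
      lin (Multiplicative.toAdd (a * b)) =
        (lin (Multiplicative.toAdd a)).comp (lin (Multiplicative.toAdd b)) :=
    fun a b ↦ LinearMap.ext fun x ↦ rfl
  -- matrices as additive automorphisms
  let aut : GL (Fin 2) (ZMod ℓ) → AddAut A := fun M ↦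
    { toFun := Matrix.toLin c c (M : Matrix (Fin 2) (Fin 2) (ZMod ℓ))
      invFun := Matrix.toLin c c ((M⁻¹ : GL (Fin 2) (ZMod ℓ)) : Matrix (Fin 2) (Fin 2) (ZMod ℓ))
      left_inv := fun x ↦ by
        rw [← LinearMap.comp_apply, ← Matrix.toLin_mul c c c, Units.inv_mul, Matrix.toLin_one,
          LinearMap.id_apply]
      right_inv := fun x ↦ by
        rw [← LinearMap.comp_apply, ← Matrix.toLin_mul c c c, Units.mul_inv, Matrix.toLin_one,
          LinearMap.id_apply]
      map_add' := fun x y ↦ map_add _ x y }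
  have haut : ∀ M, lin (aut M) = Matrix.toLin c c (M : Matrix (Fin 2) (Fin 2) (ZMod ℓ)) :=
    fun M ↦ LinearMap.ext fun x ↦ rfl
  -- the group isomorphism `Aut(A) ≃* GL₂(𝔽_ℓ)`
  let Φ : Multiplicative (AddAut A) ≃* GL (Fin 2) (ZMod ℓ) :=
    { toFun := fun g ↦
        { val := LinearMap.toMatrix c c (lin (Multiplicative.toAdd g))
          inv := LinearMap.toMatrix c c (lin (Multiplicative.toAdd g).symm)
          val_inv := by
            rw [← LinearMap.toMatrix_comp c c c, hlin_comp_symm, LinearMap.toMatrix_id]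
          inv_val := by
            rw [← LinearMap.toMatrix_comp c c c, hlin_symm_comp, LinearMap.toMatrix_id] }
      invFun := fun M ↦ Multiplicative.ofAdd (aut M)
      left_inv := fun g ↦ by
        refine congrArg Multiplicative.ofAdd (AddEquiv.ext fun x ↦ ?_)
        show Matrix.toLin c c (LinearMap.toMatrix c c (lin (Multiplicative.toAdd g))) x = _
        rw [Matrix.toLin_toMatrix]
        rfl
      right_inv := fun M ↦ Units.ext (by
        show LinearMap.toMatrix c c (lin (aut M)) = M
        rw [haut, LinearMap.toMatrix_toLin])
      map_mul' := fun a b ↦ Units.ext (by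
        show LinearMap.toMatrix c c (lin (Multiplicative.toAdd (a * b))) =
          LinearMap.toMatrix c c (lin (Multiplicative.toAdd a)) *
            LinearMap.toMatrix c c (lin (Multiplicative.toAdd b))
        rw [hlin_mul, LinearMap.toMatrix_comp c c c]) }
  have hΦ : ∀ g : Multiplicative (AddAut A),
      ((Φ g : GL (Fin 2) (ZMod ℓ)) : Matrix (Fin 2) (Fin 2) (ZMod ℓ)) =
        LinearMap.toMatrix c c (lin (Multiplicative.toAdd g)) := fun g ↦ rfl
  refine ⟨c.equivFun.toAddEquiv, Φ, fun g x ↦ ?_, fun g ↦ ?_, fun g ↦ ?_⟩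
  · show c.equivFun (lin (Multiplicative.toAdd g) x) = _ *ᵥ c.equivFun x
    rw [hΦ, Module.Basis.equivFun_apply, Module.Basis.equivFun_apply,
      LinearMap.toMatrix_mulVec_repr]
  · rw [hΦ, ← LinearMap.trace_eq_matrix_trace (ZMod ℓ) c]
  · rw [hΦ, LinearMap.det_toMatrix]

end Plane

/-! ### §5.2 (iii)–(iv) for `ℚ`: the mod-`ℓ` cyclotomic character is onto, and is `-1` at `conj` -/

section RatCyclotomic

open Literature.NumberTheory.GaloisRepresentations Field

variable (ℓ : ℕ) [Fact ℓ.Prime]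

/-- **§5.2 (iii): the mod-`ℓ` cyclotomic character `χ̄_ℓ : Γ_ℚ → 𝔽_ℓˣ` is onto** ("son image
est le groupe de Galois du `l`-ième corps cyclotomique"): the `ℓ`-adic character is onto
(`GaloisRep.cyclotomicCharacter_surjective`, irreducibility of the cyclotomic polynomials over
`ℚ`) and `χ̄_ℓ = χ_ℓ mod ℓ` (`toZMod_cyclotomicCharacter_apply`). [cite: Serre1972, §5.2 (iii)] -/
theorem modPCyclotomicCharacterZMod_rat_surjective [NeZero (ℓ : ℚ)] :
    Function.Surjective (modPCyclotomicCharacterZMod ℚ ℓ) := by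
  intro u
  -- lift `u` to a unit of `ℤ_ℓ`
  obtain ⟨y, hy⟩ := ZMod.ringHom_surjective (PadicInt.toZMod (p := ℓ)) (u : ZMod ℓ)
  have hyu : IsUnit y := by
    by_contra h
    have hmem : y ∈ IsLocalRing.maximalIdeal ℤ_[ℓ] := h
    rw [← PadicInt.ker_toZMod, RingHom.mem_ker, hy] at hmem
    exact u.ne_zero hmem
  obtain ⟨σ, hσ⟩ := GaloisRep.cyclotomicCharacter_surjective ℚ ℓ
    (fun n hn ↦ Polynomial.cyclotomic.irreducible_rat hn) hyu.unit
  refine ⟨σ, Units.ext ?_⟩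
  rw [← toZMod_cyclotomicCharacter_apply ℚ ℓ σ, hσ, IsUnit.unit_spec, hy]

/-- **§5.2 (iv): complex conjugation.**  There is `c ∈ Γ_ℚ` with `c² = 1` on which the mod-`ℓ`
cyclotomic character is `-1` (a complex conjugation for the real embedding of `ℚ`:
`exists_isComplexConjugation`, `IsComplexConjugation.sq_eq_one`,
`modNCyclotomicCharacter_of_isComplexConjugation`). [cite: Serre1972, §5.2 (iv)] -/
theorem exists_sq_eq_one_modPCyclotomicCharacterZMod_eq_neg_one [NeZero (ℓ : ℚ)] :
    ∃ c : absoluteGaloisGroup ℚ, c ^ 2 = 1 ∧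
      ((modPCyclotomicCharacterZMod ℚ ℓ c : (ZMod ℓ)ˣ) : ZMod ℓ) = -1 := by
  obtain ⟨c, hc⟩ := exists_isComplexConjugation (Rat.castHom ℝ)
  haveI : NeZero ℓ := ⟨(Fact.out : ℓ.Prime).ne_zero⟩
  refine ⟨c, hc.sq_eq_one, ?_⟩
  rw [modPCyclotomicCharacterZMod_eq_modNCyclotomicCharacter]
  exact modNCyclotomicCharacter_of_isComplexConjugation hc

end RatCyclotomic

end Literature.NumberTheory.EllipticCurves

/-! ### The determinant of the framed mod-`ℓ` representation of an elliptic curve -/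

namespace WeierstrassCurve

open Literature.NumberTheory.EllipticCurves Literature.NumberTheory.GaloisRepresentations Field

section AnyField

variable {K : Type u} [Field K] [PerfectField K] (W : WeierstrassCurve K) [W.IsElliptic]
  (ℓ : ℕ) [Fact ℓ.Prime] [NeZero (ℓ : K)]

/-- **`det ρ̄_{E,ℓ} = χ̄_ℓ` in a frame.**  For an elliptic curve `E = W` over a perfect field `K`
with `ℓ ≠ char K`, an additive frame `e : E[ℓ] ≃+ 𝔽_ℓ²` and a map `Φ : Aut(E[ℓ]) → GL₂(𝔽_ℓ)`
with `e (g x) = Φ(g) e(x)`: `det Φ(ρ̄_{E,ℓ} σ) = χ̄_ℓ(σ)` for every `σ ∈ Γ_K` — the Weil pairing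
(`det_eq_modPCyclotomicCharacterZMod_of_exists_weilPairing`, `exists_weilPairing_holds`; "le
déterminant de la représentation de `G` dans `E_p` est égal au caractère `G → 𝔽_pˣ` donnant
l'action de `G` sur `μ_p`", §1.11). [cite: Serre1972, §1.11 and §5.2 (iii)] -/
theorem det_frame_galoisRepTorsion_eq (e : geomTorsion W ℓ ≃+ (Fin 2 → ZMod ℓ))
    (Φ : Multiplicative (AddAut (geomTorsion W ℓ)) → GL (Fin 2) (ZMod ℓ))
    (he : ∀ (g : Multiplicative (AddAut (geomTorsion W ℓ))) (x : geomTorsion W ℓ),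
      e (Multiplicative.toAdd g x) =
        ((Φ g : GL (Fin 2) (ZMod ℓ)) : Matrix (Fin 2) (Fin 2) (ZMod ℓ)) *ᵥ e x)
    (σ : absoluteGaloisGroup K) :
    Matrix.det ((Φ (galoisRepTorsion W ℓ σ) : GL (Fin 2) (ZMod ℓ)) :
        Matrix (Fin 2) (Fin 2) (ZMod ℓ)) =
      ((modPCyclotomicCharacterZMod K ℓ σ : (ZMod ℓ)ˣ) : ZMod ℓ) :=
  det_eq_modPCyclotomicCharacterZMod_of_exists_weilPairing W ℓ (exists_weilPairing_holds W ℓ) e σ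
    _ fun P ↦ he (galoisRepTorsion W ℓ σ) P

/-- `det Φ(ρ̄_{E,ℓ} σ) = χ̄_ℓ(σ)` in `𝔽_ℓˣ` (units form of `det_frame_galoisRepTorsion_eq`).
[cite: Serre1972, §5.2 (iii)] -/
theorem det_frame_galoisRepTorsion_eq' (e : geomTorsion W ℓ ≃+ (Fin 2 → ZMod ℓ))
    (Φ : Multiplicative (AddAut (geomTorsion W ℓ)) → GL (Fin 2) (ZMod ℓ))
    (he : ∀ (g : Multiplicative (AddAut (geomTorsion W ℓ))) (x : geomTorsion W ℓ),
      e (Multiplicative.toAdd g x) =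
        ((Φ g : GL (Fin 2) (ZMod ℓ)) : Matrix (Fin 2) (Fin 2) (ZMod ℓ)) *ᵥ e x)
    (σ : absoluteGaloisGroup K) :
    Matrix.GeneralLinearGroup.det (Φ (galoisRepTorsion W ℓ σ)) =
      modPCyclotomicCharacterZMod K ℓ σ :=
  Units.ext (by
    rw [Matrix.GeneralLinearGroup.val_det_apply]
    exact det_frame_galoisRepTorsion_eq W ℓ e Φ he σ)

end AnyField

/-! ### The assembled statement over `ℚ` -/

section Rat

variable (W : WeierstrassCurve ℚ) [W.IsElliptic] (ℓ : ℕ) [Fact ℓ.Prime]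

/-- **Serre 1972, §5.2 (iii)–(iv) for `E/ℚ`, framed.**  For an elliptic curve `E = W/ℚ` and a
prime `ℓ` there are an additive frame `e : E[ℓ] ≃+ 𝔽_ℓ²` and a group isomorphism
`Φ : Aut(E[ℓ]) ≅ GL₂(𝔽_ℓ)` with `e (g x) = Φ(g) e(x)` and `tr Φ(g) = tr g`, such that
`det ∘ Φ ∘ ρ̄_{E,ℓ} = χ̄_ℓ` is onto `𝔽_ℓˣ` ((iii): "`det : φ_l(G) → 𝔽_lˣ` est surjectif") and
some `c = ρ̄_{E,ℓ}(conj)` satisfies `c² = 1`, `det Φ(c) = -1` ((iv): "un élément `c` de valeurs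
propres `{1, -1}` … fourni par la conjugaison complexe").  These are the inputs `hdet` and `c` of
`Serre1972.eq_top_or_borel_of_dvd_card`, `Serre1972.borel_or_normalizer_of_halfSplitCartan_le`
and `Serre1972.borel_or_normalizer_of_unitGroup_le` (`SerreOpenImageGroupLemmas`).
[cite: Serre1972, §5.2 (iii)–(iv)] -/
theorem exists_frame_galoisRepTorsion_rat :
    ∃ (e : geomTorsion W ℓ ≃+ (Fin 2 → ZMod ℓ))
      (Φ : Multiplicative (AddAut (geomTorsion W ℓ)) ≃* GL (Fin 2) (ZMod ℓ)),
      (∀ (g : Multiplicative (AddAut (geomTorsion W ℓ))) (x : geomTorsion W ℓ),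
        e (Multiplicative.toAdd g x) =
          ((Φ g : GL (Fin 2) (ZMod ℓ)) : Matrix (Fin 2) (Fin 2) (ZMod ℓ)) *ᵥ e x) ∧
      (letI : Module (ZMod ℓ) (geomTorsion W ℓ) := AddSubgroup.torsionBy.zmodModule
        ∀ g : Multiplicative (AddAut (geomTorsion W ℓ)),
          Matrix.trace ((Φ g : GL (Fin 2) (ZMod ℓ)) : Matrix (Fin 2) (Fin 2) (ZMod ℓ)) =
            LinearMap.trace (ZMod ℓ) (geomTorsion W ℓ)
              ((Multiplicative.toAdd g).toAddMonoidHom.toZModLinearMap ℓ)) ∧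
      (∀ σ : absoluteGaloisGroup ℚ,
        Matrix.GeneralLinearGroup.det (Φ (galoisRepTorsion W ℓ σ)) =
          modPCyclotomicCharacterZMod ℚ ℓ σ) ∧
      (∀ u : (ZMod ℓ)ˣ, ∃ σ : absoluteGaloisGroup ℚ,
        Matrix.GeneralLinearGroup.det (Φ (galoisRepTorsion W ℓ σ)) = u) ∧
      ∃ c : absoluteGaloisGroup ℚ,
        Φ (galoisRepTorsion W ℓ c) * Φ (galoisRepTorsion W ℓ c) = 1 ∧
          Matrix.det ((Φ (galoisRepTorsion W ℓ c) : GL (Fin 2) (ZMod ℓ)) :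
            Matrix (Fin 2) (Fin 2) (ZMod ℓ)) = -1 := by
  letI : Module (ZMod ℓ) (geomTorsion W ℓ) := AddSubgroup.torsionBy.zmodModule
  have hp : ℓ.Prime := Fact.out
  haveI : NeZero ℓ := ⟨hp.ne_zero⟩
  have hℓ' : (ℓ : AlgebraicClosure ℚ) ≠ 0 := Nat.cast_ne_zero.mpr hp.ne_zero
  have hcard : Nat.card (geomTorsion W ℓ) = ℓ ^ 2 :=
    card_torsionPoints_eq_sq_holds W (AlgebraicClosure ℚ) (n := ℓ) hℓ'
  obtain ⟨e, Φ, he, htr, -⟩ := exists_addEquiv_mulEquiv_addAut_GL2 (geomTorsion W ℓ) hcard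
  have hdet := det_frame_galoisRepTorsion_eq' W ℓ e Φ he
  refine ⟨e, Φ, he, htr, hdet, fun u ↦ ?_, ?_⟩
  · obtain ⟨σ, hσ⟩ := modPCyclotomicCharacterZMod_rat_surjective ℓ u
    exact ⟨σ, by rw [hdet, hσ]⟩
  · obtain ⟨c, hc2, hcχ⟩ := exists_sq_eq_one_modPCyclotomicCharacterZMod_eq_neg_one ℓ
    refine ⟨c, ?_, ?_⟩
    · rw [← map_mul, ← map_mul, ← sq, hc2, map_one, map_one]
    · rw [det_frame_galoisRepTorsion_eq W ℓ e Φ he c, hcχ]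

end Rat

end WeierstrassCurve
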